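import Literature.Analysis.Matrix.FiniteRangeDecompositionPow
import Literature.Analysis.Matrix.FiniteRangeDecompositionSymbol
import Literature.Analysis.Fourier.ConvolutionOperatorGradient
import HarnessLib

/-!
# Finite-range decomposition with smoother pieces, II: symbols, single-shell bounds and the
# gradient kernel bound for the power-`m` pieces

For a translation-invariant symmetric matrix `A` on a finite abelian group `G` with `0 ≤ A ≤ 4`
(Loewner) the power-`m` pieces `C^{(m)}_N = frdPiecePow A m N` and remainders
`R^{(m)}_J = frdRemainderPow A m J` of `FiniteRangeDecompositionPow.lean` are translation-invariant
convolution operators with the real nonnegative symbols (`a = σ_A(ψ) = 4 sin²(πx)`, `x = frdAngle a`)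

  `σ_{C^{(m)}_N}(ψ) = ¼ W^{(m)}_N(x)`,  `W^{(m)}_N = 4^N ρ_N^{m+1} Σ_{i<m} c_N^i`,   `σ_{R^{(m)}_J}(ψ) = ρ_J(x)^m`

(`symbol_frdPiecePow`, `symbol_frdRemainderPow`), whence the single-shell bounds

  `0 ≤ σ_{C^{(m)}_N} ≤ m·4^N/4`,   `σ_{C^{(m)}_N} · a^{m+1} ≤ m π^{2m+2}/(4·4^{Nm})`,
  `0 ≤ σ_{R^{(m)}_J} ≤ 1`,          `σ_{R^{(m)}_J} · a^m ≤ (π²/4^J)^m`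

(`symbol_frdPiecePow_re_le`, `symbol_frdPiecePow_re_mul_pow_le`, …): the piece `C^{(m)}_N` lives on
the momentum shell `a ∼ 4^{−N}` and decays like `a^{−(m+1)}` above it — `m` more powers than the
square pieces of `FiniteRangeDecompositionSymbol.lean`.  Combined with the gradient kernel bound of
`ConvolutionOperatorGradient.lean` this gives

  `|∇_{g₁}⋯∇_{g_k} C^{(m)}_N (x,y)| ≤ |G|⁻¹ Σ_ψ (Π_i ‖ψ(g_i) − 1‖) σ_{C^{(m)}_N}(ψ)`   (`abs_rowDiffs_frdPiecePow_apply_le`),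

the input of the volume-uniform gradient bounds in `d = 3` (`…PowGradient.lean`).
[cite: Bauerschmidt2013, Thm. 1.2 (ii) (form of the bounds)]; all statements [folklore].
-/

noncomputable section

open Finset Polynomial Real
open Literature.Analysis.Fourier Literature.Analysis.Fourier.TrigApprox

namespace Literature.Analysis.Matrix

variable {G : Type*} [AddCommGroup G] [Fintype G] [DecidableEq G]
variable {A : _root_.Matrix G G ℝ} (ψ : AddChar G ℂ)

/-! ## Symbols of the power-`m` pieces -/

omit [Fintype G] [DecidableEq G] in
/-- `p(c)` computed in `ℂ` is `p(c)` computed in `ℝ`. [folklore] -/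
private theorem aeval_ofReal' (c : ℝ) (p : ℝ[X]) :
    Polynomial.aeval (c : ℂ) p = ((p.eval c : ℝ) : ℂ) := by
  rw [← Complex.coe_algebraMap, Polynomial.aeval_algebraMap_apply_eq_algebraMap_eval]

omit [Fintype G] [DecidableEq G] [AddCommGroup G] in
/-- `ρ_N(cos 2πx) = F_{2^N−1}(x)/2^N`. [folklore] -/
theorem frdRatioPoly_eval_cos (N : ℕ) (x : ℝ) :
    (frdRatioPoly N).eval (Real.cos (2 * π * x)) = fejer (2 ^ N - 1) x / 2 ^ N := by
  unfold frdRatioPoly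
  rw [Polynomial.eval_mul, Polynomial.eval_C, fejerPoly_eval_cos]
  ring

omit [Fintype G] [DecidableEq G] [AddCommGroup G] in
/-- `c_N(cos 2πx) = cos²(π 2^N x)`. [folklore] -/
theorem frdHalfPoly_eval_cos (N : ℕ) (x : ℝ) :
    (frdHalfPoly N).eval (Real.cos (2 * π * x)) = Real.cos (π * (2 ^ N * x)) ^ 2 := by
  unfold frdHalfPoly
  rw [Polynomial.eval_mul, Polynomial.eval_C, Polynomial.eval_add, Polynomial.eval_one, eval_T_two_pow_cos]
  ring

omit [Fintype G] in
/-- `B = 1 − A/2` is translation invariant. [folklore] -/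
theorem isTranslationInvariant_frdCos (hA : IsTranslationInvariant A) : IsTranslationInvariant (frdCos A) :=
  IsTranslationInvariant.one.sub (hA.smul _)

/-- The power-`m` pieces are translation invariant. [folklore] -/
theorem isTranslationInvariant_frdPiecePow (hA : IsTranslationInvariant A) (m N : ℕ) :
    IsTranslationInvariant (frdPiecePow A m N) := by
  unfold frdPiecePow
  exact ((((isTranslationInvariant_frdCos hA).aeval _).pow _).mul
    (IsTranslationInvariant.sum _ fun i _ => ((isTranslationInvariant_frdCos hA).aeval _).pow _)).smul _

/-- The power-`m` remainders are translation invariant. [folklore] -/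
theorem isTranslationInvariant_frdRemainderPow (hA : IsTranslationInvariant A) (m J : ℕ) :
    IsTranslationInvariant (frdRemainderPow A m J) :=
  ((isTranslationInvariant_frdCos hA).aeval _).pow _

/-- Symbol of `ρ_N(B)`: `F_{2^N−1}(x(a))/2^N`. [folklore] -/
theorem symbol_aeval_frdRatioPoly (hA : IsTranslationInvariant A) (hs : A.IsHermitian) (h0 : A.PosSemidef)
    (h4 : ((4 : ℝ) • (1 : _root_.Matrix G G ℝ) - A).PosSemidef) (N : ℕ) :
    symbol (Polynomial.aeval (frdCos A) (frdRatioPoly N)) ψ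
      = ((fejer (2 ^ N - 1) (frdAngle (symbol A ψ).re) / 2 ^ N : ℝ) : ℂ) := by
  rw [symbol_aeval ψ (isTranslationInvariant_frdCos hA), symbol_frdCos ψ hA hs h0 h4, aeval_ofReal',
    frdRatioPoly_eval_cos]

/-- Symbol of `c_N(B)`: `cos²(π 2^N x(a))`. [folklore] -/
theorem symbol_aeval_frdHalfPoly (hA : IsTranslationInvariant A) (hs : A.IsHermitian) (h0 : A.PosSemidef)
    (h4 : ((4 : ℝ) • (1 : _root_.Matrix G G ℝ) - A).PosSemidef) (N : ℕ) :
    symbol (Polynomial.aeval (frdCos A) (frdHalfPoly N)) ψ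
      = ((Real.cos (π * (2 ^ N * frdAngle (symbol A ψ).re)) ^ 2 : ℝ) : ℂ) := by
  rw [symbol_aeval ψ (isTranslationInvariant_frdCos hA), symbol_frdCos ψ hA hs h0 h4, aeval_ofReal',
    frdHalfPoly_eval_cos]

/-- **Symbol of the `N`-th power-`m` piece**: `σ_{C^{(m)}_N}(ψ) = ¼ W^{(m)}_N(x(a))`, `a = σ_A(ψ)`,
`W^{(m)}_N(x) = 4^N (F_{2^N−1}(x)/2^N)^{m+1} Σ_{i<m} cos²(π2^N x)^i`. [cite: Bauerschmidt2013, Thm. 1.2 (ii) (form)] -/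
theorem symbol_frdPiecePow (hA : IsTranslationInvariant A) (hs : A.IsHermitian) (h0 : A.PosSemidef)
    (h4 : ((4 : ℝ) • (1 : _root_.Matrix G G ℝ) - A).PosSemidef) (m N : ℕ) :
    symbol (frdPiecePow A m N) ψ
      = ((1 / 4 * (4 ^ N * (fejer (2 ^ N - 1) (frdAngle (symbol A ψ).re) / 2 ^ N) ^ (m + 1)
          * ∑ i ∈ Finset.range m, (Real.cos (π * (2 ^ N * frdAngle (symbol A ψ).re)) ^ 2) ^ i) : ℝ) : ℂ) := by
  unfold frdPiecePow
  have hB := isTranslationInvariant_frdCos hA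
  have hS : IsTranslationInvariant
      (∑ i ∈ Finset.range m, (Polynomial.aeval (frdCos A) (frdHalfPoly N)) ^ i) :=
    IsTranslationInvariant.sum _ fun i _ => (hB.aeval _).pow _
  rw [symbol_smul, symbol_mul ψ _ hS, symbol_pow ψ (hB.aeval _), symbol_sum,
    symbol_aeval_frdRatioPoly ψ hA hs h0 h4]
  simp_rw [symbol_pow ψ (hB.aeval _), symbol_aeval_frdHalfPoly ψ hA hs h0 h4]
  push_cast
  ring

/-- **Symbol of the power-`m` remainder**: `σ_{R^{(m)}_J}(ψ) = (F_{2^J−1}(x(a))/2^J)^m`.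
[cite: Bauerschmidt2013, Thm. 1.2 (ii) (form)] -/
theorem symbol_frdRemainderPow (hA : IsTranslationInvariant A) (hs : A.IsHermitian) (h0 : A.PosSemidef)
    (h4 : ((4 : ℝ) • (1 : _root_.Matrix G G ℝ) - A).PosSemidef) (m J : ℕ) :
    symbol (frdRemainderPow A m J) ψ
      = (((fejer (2 ^ J - 1) (frdAngle (symbol A ψ).re) / 2 ^ J) ^ m : ℝ) : ℂ) := by
  unfold frdRemainderPow
  rw [symbol_pow ψ ((isTranslationInvariant_frdCos hA).aeval _), symbol_aeval_frdRatioPoly ψ hA hs h0 h4]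
  push_cast
  ring

/-! ## Single-shell bounds on the symbols -/

section Bounds

variable (hA : IsTranslationInvariant A) (hs : A.IsHermitian) (h0 : A.PosSemidef)
  (h4 : ((4 : ℝ) • (1 : _root_.Matrix G G ℝ) - A).PosSemidef)
include hA hs h0 h4

/-- The symbol of a power-`m` piece is real. [folklore] -/
theorem symbol_frdPiecePow_im (m N : ℕ) : (symbol (frdPiecePow A m N) ψ).im = 0 := by
  rw [symbol_frdPiecePow ψ hA hs h0 h4 m N, Complex.ofReal_im]

/-- `0 ≤ σ_{C^{(m)}_N}(ψ)`. [folklore] -/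
theorem symbol_frdPiecePow_re_nonneg (m N : ℕ) : 0 ≤ (symbol (frdPiecePow A m N) ψ).re := by
  rw [symbol_frdPiecePow ψ hA hs h0 h4 m N, Complex.ofReal_re]
  exact mul_nonneg (by norm_num) (fejer_dyadic_piece_pow_nonneg m N _)

/-- **Ultraviolet bound**: `σ_{C^{(m)}_N}(ψ) ≤ m·4^N/4`. [folklore] -/
theorem symbol_frdPiecePow_re_le (m N : ℕ) : (symbol (frdPiecePow A m N) ψ).re ≤ m * 4 ^ N / 4 := by
  rw [symbol_frdPiecePow ψ hA hs h0 h4 m N, Complex.ofReal_re]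
  have := fejer_dyadic_piece_pow_le m N (frdAngle (symbol A ψ).re)
  linarith

/-- **Infrared bound**: `σ_{C^{(m)}_N}(ψ) · a^{m+1} ≤ m π^{2m+2}/(4·4^{Nm})`, `a = σ_A(ψ)` — the piece
`C^{(m)}_N` lives on the momentum shell `a ∼ 4^{−N}` and decays like `a^{−(m+1)}` above it. [folklore] -/
theorem symbol_frdPiecePow_re_mul_pow_le (m N : ℕ) :
    (symbol (frdPiecePow A m N) ψ).re * (symbol A ψ).re ^ (m + 1)
      ≤ m * π ^ (2 * m + 2) / (4 * 4 ^ (N * m)) := by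
  have hmem := symbol_re_mem_Icc ψ hA h0 h4
  set a := (symbol A ψ).re with ha
  rw [symbol_frdPiecePow ψ hA hs h0 h4 m N, Complex.ofReal_re]
  rcases eq_or_lt_of_le hmem.1 with h | hpos
  · rw [← h]; simp; positivity
  set x := frdAngle a with hxdef
  have hx0 : x ≠ 0 := frdAngle_ne_zero hpos hmem.2
  have hW := fejer_dyadic_piece_pow_le_inv m N hx0 (abs_frdAngle_le _)
  have hJ : a ≤ 4 * π ^ 2 * x ^ 2 := le_four_pi_sq_mul_frdAngle_sq hmem.1 hmem.2
  have hx2 : 0 < x ^ 2 := by positivity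
  have hW0 : 0 ≤ 4 ^ N * (fejer (2 ^ N - 1) x / 2 ^ N) ^ (m + 1)
      * ∑ i ∈ Finset.range m, (Real.cos (π * (2 ^ N * x)) ^ 2) ^ i := fejer_dyadic_piece_pow_nonneg m N x
  -- `¼ W a^{m+1} ≤ ¼ · m4^N/(4·4^N x²)^{m+1} · (4π²x²)^{m+1} = ¼ m 4^N (π²/4^N)^{m+1}`
  calc 1 / 4 * (4 ^ N * (fejer (2 ^ N - 1) x / 2 ^ N) ^ (m + 1)
          * ∑ i ∈ Finset.range m, (Real.cos (π * (2 ^ N * x)) ^ 2) ^ i) * a ^ (m + 1)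
      ≤ 1 / 4 * (m * 4 ^ N / (4 * 4 ^ N * x ^ 2) ^ (m + 1)) * (4 * π ^ 2 * x ^ 2) ^ (m + 1) := by
        gcongr
    _ = m * π ^ (2 * m + 2) / (4 * 4 ^ (N * m)) := by
        have h4N : (0 : ℝ) < 4 ^ N := by positivity
        rw [show π ^ (2 * m + 2) = (π ^ 2) ^ (m + 1) by rw [← pow_mul]; ring_nf, pow_mul (4 : ℝ) N m]
        set T4 : ℝ := 4 ^ N with hT4
        simp only [mul_pow]
        field_simp
        ring

/-- The symbol of a power-`m` remainder is real. [folklore] -/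
theorem symbol_frdRemainderPow_im (m J : ℕ) : (symbol (frdRemainderPow A m J) ψ).im = 0 := by
  rw [symbol_frdRemainderPow ψ hA hs h0 h4 m J, Complex.ofReal_im]

/-- `0 ≤ σ_{R^{(m)}_J}(ψ)`. [folklore] -/
theorem symbol_frdRemainderPow_re_nonneg (m J : ℕ) : 0 ≤ (symbol (frdRemainderPow A m J) ψ).re := by
  rw [symbol_frdRemainderPow ψ hA hs h0 h4 m J, Complex.ofReal_re]
  exact pow_nonneg (fejer_two_pow_div_nonneg J _) m

/-- `σ_{R^{(m)}_J}(ψ) ≤ 1`. [folklore] -/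
theorem symbol_frdRemainderPow_re_le_one (m J : ℕ) : (symbol (frdRemainderPow A m J) ψ).re ≤ 1 := by
  rw [symbol_frdRemainderPow ψ hA hs h0 h4 m J, Complex.ofReal_re]
  exact pow_le_one₀ (fejer_two_pow_div_nonneg J _) (fejer_two_pow_div_le_one J _)

/-- **Infrared bound for the remainder**: `σ_{R^{(m)}_J}(ψ) · a^m ≤ (π²/4^J)^m`. [folklore] -/
theorem symbol_frdRemainderPow_re_mul_pow_le (m J : ℕ) :
    (symbol (frdRemainderPow A m J) ψ).re * (symbol A ψ).re ^ m ≤ (π ^ 2 / 4 ^ J) ^ m := by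
  rw [symbol_frdRemainderPow ψ hA hs h0 h4 m J, Complex.ofReal_re, ← mul_pow]
  have h1 := symbol_frdRemainder_re_mul_le ψ hA hs h0 h4 J
  rw [symbol_frdRemainder ψ hA hs h0 h4 J, Complex.ofReal_re] at h1
  exact pow_le_pow_left₀ (mul_nonneg (fejer_two_pow_div_nonneg J _) (symbol_re_mem_Icc ψ hA h0 h4).1) h1 m

/-! ## Kernel bounds -/

omit h0 in
/-- **Kernel bound for the power-`m` pieces**: `|C^{(m)}_N(x,y)| ≤ |G|⁻¹ Σ_ψ σ_{C^{(m)}_N}(ψ)`.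
[cite: BrydgesGuadagniMitter2004, Thm. 1.1 (form of the bound)] -/
theorem abs_frdPiecePow_apply_le (m N : ℕ) (x y : G) :
    |frdPiecePow A m N x y|
      ≤ (Fintype.card G : ℝ)⁻¹ * ∑ φ : AddChar G ℂ, (symbol (frdPiecePow A m N) φ).re :=
  abs_apply_le_avg_symbol (isTranslationInvariant_frdPiecePow hA m N) (posSemidef_frdPiecePow hs h4 m N) x y

/-- **Gradient kernel bound for the power-`m` pieces**: for every list of steps `l = [g₁,…,g_k]`,
`|∇_{g₁}⋯∇_{g_k} C^{(m)}_N (x,y)| ≤ |G|⁻¹ Σ_ψ (Π_i ‖ψ(g_i) − 1‖) · σ_{C^{(m)}_N}(ψ)`.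
[cite: Bauerschmidt2013, Thm. 1.2 (the `∇^α` bounds are momentum sums with `|α|` momentum factors)] -/
theorem abs_rowDiffs_frdPiecePow_apply_le (m N : ℕ) (l : List G) (x y : G) :
    |rowDiffs l (frdPiecePow A m N) x y|
      ≤ (Fintype.card G : ℝ)⁻¹ * ∑ φ : AddChar G ℂ,
          (l.map fun g => ‖φ g - 1‖).prod * (symbol (frdPiecePow A m N) φ).re :=
  abs_rowDiffs_apply_le_of_re (isTranslationInvariant_frdPiecePow hA m N)
    (fun φ => symbol_frdPiecePow_im φ hA hs h0 h4 m N) (fun φ => symbol_frdPiecePow_re_nonneg φ hA hs h0 h4 m N)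
    l x y

omit h0 in
/-- Kernel bound for the power-`m` remainder: `|R^{(m)}_J(x,y)| ≤ |G|⁻¹ Σ_ψ σ_{R^{(m)}_J}(ψ)`.
[cite: BrydgesGuadagniMitter2004, Thm. 1.1 (form of the bound)] -/
theorem abs_frdRemainderPow_apply_le (m J : ℕ) (x y : G) :
    |frdRemainderPow A m J x y|
      ≤ (Fintype.card G : ℝ)⁻¹ * ∑ φ : AddChar G ℂ, (symbol (frdRemainderPow A m J) φ).re :=
  abs_apply_le_avg_symbol (isTranslationInvariant_frdRemainderPow hA m J)
    (posSemidef_frdRemainderPow hs h4 m J) x y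

end Bounds

end Literature.Analysis.Matrix

end
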